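import Literature.Analysis.FunctionSpaces.PolchinskiFluctuationHeat
import HarnessLib

/-!
# Differentiating fluctuation averages of a time-dependent family: `d/dt E_{C_∞−C_t}[K_t]`
# (toolkit for Bauerschmidt–Bodineau–Dagallier §3.2–3.3)

Topic `Literature/Analysis/FunctionSpaces`; ninth "proof architecture" file behind the named fact
`Polchinski.BauerschmidtBodineau_multiscaleBakryEmery` ([BBD] Theorem 3, `MultiscaleBakryEmery.lean`).
Both remaining analytic steps of [BBD] §3.2–3.3 — the dual identity with a time-dependent test function,
`−d/dt E_{ν_t}[G_t] = E_{ν_t}[L_tG_t − ∂_tG_t]` (used with `G_t = Φ(P_{0,t}F)` in the entropy production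
formula (e:dEnt), proof of Theorem 3, p0016 L47–75), and the monotonicity `ψ′(s) ≤ 0` (p0016 L150–153) —
are derivatives of fluctuation averages `s ↦ E_{C_∞−C_s}[K_s]` of a FAMILY of integrands.  This file
proves the general rule behind them, abstracting `PolchinskiDualGenerator.lean` (where `K_s = e^{−V_s}F`):
if `K_t ∈ C_b²` (bounded, bounded uniformly continuous Hessian), the `K_s` are uniformly bounded and
continuous, and `s ↦ K_s(y)` is differentiable at `s = t` UNIFORMLY in `y` with a bounded uniformly
continuous derivative `K̇`, then
`d/ds E_{C_∞−C_s}[K_s(φ+·)] |_{s=t} = −½ Σ Ċ_t^{ij} E_{C_∞−C_t}[∂_i∂_jK_t(φ+·)] + E_{C_∞−C_t}[K̇(φ+·)]`,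
together with the uniform-in-space differentiability of Gaussian smoothing `s ↦ E_{C_s}[G(y+·)]` for any
`G ∈ C_b²` (the source of such uniform hypotheses; [BBD] Prop 5 with base-point-uniform two-scale bounds).

## Main results (sorry-free; no new definitions, no new named facts)

* `eventually_abs_integral_sub_sub_mul_le` — for `G ∈ C_b²`, `t > 0`, `ε > 0`: eventually in `s`,
  `sup_y |E_{C_s}[G(y+·)] − E_{C_t}[G(y+·)] − (s−t)·½ΣĊ_t^{ij}E_{C_t}[∂_i∂_jG(y+·)]| ≤ ε|s−t|`.
* **`hasDerivAt_integral_family_Cinf_sub`** — the differentiation rule for `s ↦ E_{C_∞−C_s}[K_s(φ+·)]`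
  displayed above.

Nothing here concerns Yang–Mills.

## References

* [BauerschmidtBodineauDagallier2023] R. Bauerschmidt, T. Bodineau, B. Dagallier, Probab. Surveys 21
  (2024) 200–290, arXiv:2307.07619 — Prop 5 p0014, Prop 8 proof p0015, Thm 3 proof p0016. READ (held).
-/

noncomputable section

-- nested operator-norm instances `E →L[ℝ] E →L[ℝ] ℝ`
set_option maxSynthPendingDepth 2

open MeasureTheory ProbabilityTheory Filter Topology Set Asymptotics
open scoped RealInnerProductSpace Matrix MatrixOrder

namespace Literature.Analysis.FunctionSpaces

namespace Polchinski

variable {N : ℕ}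

section Helpers

/-- Matrix elements of a bounded uniformly continuous Hessian: measurable, bounded, uniformly
continuous (scalar functions). [folklore] -/
private theorem eval₂_facts' {D2 : EuclideanSpace ℝ (Fin N) →
      EuclideanSpace ℝ (Fin N) →L[ℝ] EuclideanSpace ℝ (Fin N) →L[ℝ] ℝ}
    {M : ℝ} (hM : ∀ x, ‖D2 x‖ ≤ M) (hUC : UniformContinuous D2) (i j : Fin N) :
    Continuous (fun x => D2 x (EuclideanSpace.single i 1) (EuclideanSpace.single j 1)) ∧
    (∀ x, |D2 x (EuclideanSpace.single i 1) (EuclideanSpace.single j 1)| ≤ M) ∧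
    UniformContinuous (fun x => D2 x (EuclideanSpace.single i 1) (EuclideanSpace.single j 1)) := by
  have hev : UniformContinuous fun L : EuclideanSpace ℝ (Fin N) →L[ℝ] EuclideanSpace ℝ (Fin N) →L[ℝ] ℝ =>
      L (EuclideanSpace.single i 1) (EuclideanSpace.single j 1) :=
    (ContinuousLinearMap.apply ℝ ℝ (EuclideanSpace.single j (1:ℝ))).uniformContinuous.comp
      (ContinuousLinearMap.apply ℝ (EuclideanSpace ℝ (Fin N) →L[ℝ] ℝ)
        (EuclideanSpace.single i (1:ℝ))).uniformContinuous
  refine ⟨(hev.comp hUC).continuous, fun x => ?_, hev.comp hUC⟩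
  rw [← Real.norm_eq_abs]
  calc ‖D2 x (EuclideanSpace.single i 1) (EuclideanSpace.single j 1)‖
      ≤ ‖D2 x (EuclideanSpace.single i 1)‖ * ‖EuclideanSpace.single j (1:ℝ)‖ :=
        ContinuousLinearMap.le_opNorm _ _
    _ ≤ ‖D2 x‖ * ‖EuclideanSpace.single i (1:ℝ)‖ * ‖EuclideanSpace.single j (1:ℝ)‖ :=
        mul_le_mul_of_nonneg_right (ContinuousLinearMap.le_opNorm _ _) (norm_nonneg _)
    _ = ‖D2 x‖ := by simp
    _ ≤ M := hM x

/-- `|∫ f| ≤ C` on a probability space when `|f| ≤ C` pointwise. [folklore] -/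
private theorem abs_integral_le_of_abs_le {f : EuclideanSpace ℝ (Fin N) → ℝ} {C : ℝ}
    (P : Measure (EuclideanSpace ℝ (Fin N))) [IsProbabilityMeasure P] (hf : ∀ x, |f x| ≤ C) :
    |∫ x, f x ∂P| ≤ C := by
  have h := norm_integral_le_of_norm_le_const (μ := P) (f := f) (C := C)
    (Eventually.of_forall fun x => by rw [Real.norm_eq_abs]; exact hf x)
  rwa [Real.norm_eq_abs, probReal_univ, mul_one] at h

/-- `|∫ f| ≤ C` on a probability space when `|f| ≤ C` pointwise. [folklore] -/
private theorem abs_integral_le_of_abs_le' {f : EuclideanSpace ℝ (Fin N) → ℝ} {C : ℝ}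
    (P : Measure (EuclideanSpace ℝ (Fin N))) [IsProbabilityMeasure P] (hf : ∀ x, |f x| ≤ C) :
    |∫ x, f x ∂P| ≤ C := by
  have h := norm_integral_le_of_norm_le_const (μ := P) (f := f) (C := C)
    (Eventually.of_forall fun x => by rw [Real.norm_eq_abs]; exact hf x)
  rwa [Real.norm_eq_abs, probReal_univ, mul_one] at h

end Helpers

section Family

variable (D : CovDecomposition N)

-- one long ε-bookkeeping proof (two cases, five error terms); the budget is for its many small steps
set_option maxHeartbeats 800000 in
/-- **Uniform-in-space differentiability of Gaussian smoothing along the decomposition**: for `G` bounded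
with bounded uniformly continuous Hessian, `t > 0` and every `ε > 0`, eventually (as `s → t`)
`|E_{C_s}[G(y+·)] − E_{C_t}[G(y+·)] − (s−t)·½ΣĊ_t^{ij}E_{C_t}[∂_i∂_jG(y+·)]| ≤ ε|s−t|` for ALL `y` simultaneously
([BBD] Prop 5 with the two-scale bounds uniform in the base point; the version for `G = e^{−V₀}` is
`eventually_abs_integral_exp_neg_sub_sub_mul_le`). [cite: BauerschmidtBodineauDagallier2023, Proposition 5 (proof)] -/
theorem eventually_abs_integral_sub_sub_mul_le {G : EuclideanSpace ℝ (Fin N) → ℝ}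
    {D1 : EuclideanSpace ℝ (Fin N) → EuclideanSpace ℝ (Fin N) →L[ℝ] ℝ}
    {D2 : EuclideanSpace ℝ (Fin N) → EuclideanSpace ℝ (Fin N) →L[ℝ] EuclideanSpace ℝ (Fin N) →L[ℝ] ℝ}
    (hG1 : ∀ x, HasFDerivAt G (D1 x) x)
    (hG2 : ∀ x, HasFDerivAt D1 (D2 x) x) {K0 : ℝ} (hGb : ∀ x, |G x| ≤ K0)
    {M : ℝ} (hM : ∀ x, ‖D2 x‖ ≤ M) (hUC : UniformContinuous D2)
    {t : ℝ} (ht : 0 < t) {ε : ℝ} (hε : 0 < ε) :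
    ∀ᶠ s in 𝓝 t, ∀ y : EuclideanSpace ℝ (Fin N),
      |(∫ ζ, G (y + ζ) ∂(multivariateGaussian 0 (D.C s))) -
          (∫ ζ, G (y + ζ) ∂(multivariateGaussian 0 (D.C t))) -
          (s - t) * ((1 / 2) * ∑ i, ∑ j, D.Cdot t i j *
            ∫ w, D2 (y + w) (EuclideanSpace.single i 1) (EuclideanSpace.single j 1)
              ∂(multivariateGaussian 0 (D.C t)))| ≤ ε * |s - t| := by
  have hD2m : Measurable D2 := hUC.continuous.measurable
  have hM0 : 0 ≤ M := le_trans (norm_nonneg _) (hM 0)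
  set K4 : ℝ := ∫ z, ‖z‖ ^ 4 ∂(stdGaussian (EuclideanSpace ℝ (Fin N))) with hK4
  have hK40 : 0 ≤ K4 := integral_nonneg fun z => by positivity
  -- the Hessian averages at scale `t` and their bound
  have hI : ∀ (r : ℝ) (i j : Fin N) (y : EuclideanSpace ℝ (Fin N)),
      |∫ w, D2 (y + w) (EuclideanSpace.single i 1) (EuclideanSpace.single j 1)
        ∂(multivariateGaussian 0 (D.C r))| ≤ M := by
    intro r i j y
    obtain ⟨-, hb2, -⟩ := eval₂_facts' hM hUC i j
    exact abs_integral_le_of_abs_le' _ fun w => hb2 (y + w)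
  -- scales
  set T : ℝ := ∑ i, (|D.Cdot t i i| + 1) + 1 with hT
  set T2 : ℝ := ∑ i, ∑ j, (|D.Cdot t i j| + 1) + 1 with hT2
  have hT0 : 0 < T := by positivity
  have hT20 : 0 < T2 := by positivity
  set CN : ℝ := ∑ _i : Fin N, ∑ _j : Fin N, (1:ℝ) with hCN
  have hCN0 : 0 ≤ CN := by positivity
  -- small parameters
  set ε₁ : ℝ := ε / (4 * T) with hε₁
  have hε₁0 : 0 < ε₁ := by positivity
  obtain ⟨δ, hδ, hUCδ⟩ : ∃ δ > 0, ∀ x y : EuclideanSpace ℝ (Fin N), ‖x - y‖ < δ → ‖D2 x - D2 y‖ ≤ ε₁ := by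
    obtain ⟨δ, hδ, h⟩ := Metric.uniformContinuous_iff.mp hUC ε₁ hε₁0
    refine ⟨δ, hδ, fun x y hxy => ?_⟩
    have h' := h (a := x) (b := y) (by rwa [dist_eq_norm])
    rw [dist_eq_norm] at h'
    exact h'.le
  set ε₂ : ℝ := min 1 (ε / (4 * (M * CN + 1))) with hε₂
  have hε₂0 : 0 < ε₂ := lt_min one_pos (by positivity)
  have hε₂1 : ε₂ ≤ 1 := min_le_left _ _
  have hε₂2 : ε₂ ≤ ε / (4 * (M * CN + 1)) := min_le_right _ _
  set ε₃ : ℝ := ε / (4 * T2) with hε₃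
  have hε₃0 : 0 < ε₃ := by positivity
  obtain ⟨δ₃, hδ₃, hUCδ₃⟩ : ∃ δ₃ > 0, ∀ i j, ∀ x y : EuclideanSpace ℝ (Fin N), ‖x - y‖ < δ₃ →
      |D2 x (EuclideanSpace.single i 1) (EuclideanSpace.single j 1) -
        D2 y (EuclideanSpace.single i 1) (EuclideanSpace.single j 1)| ≤ ε₃ / 2 := by
    obtain ⟨δ₃, hδ₃, h⟩ := Metric.uniformContinuous_iff.mp hUC (ε₃ / 2) (half_pos hε₃0)
    refine ⟨δ₃, hδ₃, fun i j x y hxy => ?_⟩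
    have h' := (h (a := x) (b := y) (by rwa [dist_eq_norm])).le
    rw [dist_eq_norm] at h'
    rw [← _root_.sub_apply, ← _root_.sub_apply, ← Real.norm_eq_abs]
    calc ‖(D2 x - D2 y) (EuclideanSpace.single i 1) (EuclideanSpace.single j 1)‖
        ≤ ‖(D2 x - D2 y) (EuclideanSpace.single i 1)‖ * ‖EuclideanSpace.single j (1:ℝ)‖ :=
          ContinuousLinearMap.le_opNorm _ _
      _ ≤ ‖D2 x - D2 y‖ * ‖EuclideanSpace.single i (1:ℝ)‖ * ‖EuclideanSpace.single j (1:ℝ)‖ :=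
          mul_le_mul_of_nonneg_right (ContinuousLinearMap.le_opNorm _ _) (norm_nonneg _)
      _ = ‖D2 x - D2 y‖ := by simp
      _ ≤ ε₃ / 2 := h'
  -- eventual facts as `s → t`
  have evA : ∀ᶠ s in 𝓝 t, ∀ i j, |D.C s i j - D.C t i j - (s - t) * D.Cdot t i j| ≤ ε₂ * |s - t| := by
    have h : ∀ i j, ∀ᶠ s in 𝓝 t, |D.C s i j - D.C t i j - (s - t) * D.Cdot t i j| ≤ ε₂ * |s - t| := by
      intro i j
      have hl := ((D.hasDerivAt_C t ht.le i j).isLittleO).def hε₂0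
      filter_upwards [hl] with s hs
      simpa [Real.norm_eq_abs, smul_eq_mul] using hs
    exact eventually_all.2 fun i => eventually_all.2 fun j => h i j
  have evC : ∀ᶠ s in 𝓝 t, 0 < s := isOpen_Ioi.mem_nhds ht
  have evD : ∀ᶠ s in 𝓝 t, |s - t| < ε / (4 * (2 * M / δ ^ 2 * K4 * T2 ^ 2 + 1)) := by
    have h0 : Tendsto (fun s : ℝ => s - t) (𝓝 t) (𝓝 (t - t)) := tendsto_id.sub_const t
    rw [sub_self] at h0
    have h := h0.abs
    rw [abs_zero] at h
    exact (tendsto_order.1 h).2 _ (by positivity)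
  have evE : ∀ᶠ s in 𝓝 t, 2 * M / δ₃ ^ 2 * |∑ i, (D.C t i i - D.C s i i)| < ε₃ / 2 := by
    have h0 : ∀ i, Tendsto (fun s => D.C t i i - D.C s i i) (𝓝 t) (𝓝 0) := by
      intro i
      have h := (D.hasDerivAt_C t ht.le i i).continuousAt.tendsto.const_sub (D.C t i i)
      rw [sub_self] at h
      exact h
    have h := ((tendsto_finsetSum (Finset.univ : Finset (Fin N)) fun i _ => h0 i).abs).const_mul
      (2 * M / δ₃ ^ 2)
    simp only [Finset.sum_const_zero, abs_zero, mul_zero] at h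
    exact (tendsto_order.1 h).2 _ (half_pos hε₃0)
  filter_upwards [evA, evC, evD, evE] with s hsA hs0 hsD hsE y
  -- abbreviations
  set a : ℝ := |s - t| with ha
  have ha0 : 0 ≤ a := abs_nonneg _
  have hSij : ∀ i j, |D.C s i j - D.C t i j| ≤ a * (|D.Cdot t i j| + 1) := by
    intro i j
    have h1 := hsA i j
    calc |D.C s i j - D.C t i j|
        = |(D.C s i j - D.C t i j - (s - t) * D.Cdot t i j) + (s - t) * D.Cdot t i j| := by ring_nf
      _ ≤ |D.C s i j - D.C t i j - (s - t) * D.Cdot t i j| + |(s - t) * D.Cdot t i j| :=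
          abs_add_le _ _
      _ ≤ ε₂ * a + a * |D.Cdot t i j| := by rw [abs_mul]; gcongr
      _ ≤ 1 * a + a * |D.Cdot t i j| := by gcongr
      _ = a * (|D.Cdot t i j| + 1) := by ring
  -- trace and ℓ¹ bounds for `C_s − C_t` (either orientation)
  have htr : ∀ (S : Matrix (Fin N) (Fin N) ℝ), (∀ i j, |S i j| = |D.C s i j - D.C t i j|) →
      ∑ i, S i i ≤ a * T ∧ ∑ i, ∑ j, |S i j| ≤ a * T2 := by
    intro S hS
    constructor
    · calc ∑ i, S i i ≤ ∑ i, |S i i| := Finset.sum_le_sum fun i _ => le_abs_self _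
        _ ≤ ∑ i, a * (|D.Cdot t i i| + 1) := Finset.sum_le_sum fun i _ => by rw [hS]; exact hSij i i
        _ = a * ∑ i, (|D.Cdot t i i| + 1) := by rw [Finset.mul_sum]
        _ ≤ a * T := by
            apply mul_le_mul_of_nonneg_left _ ha0
            rw [hT]; linarith only
    · calc ∑ i, ∑ j, |S i j| ≤ ∑ i, ∑ j, a * (|D.Cdot t i j| + 1) :=
            Finset.sum_le_sum fun i _ => Finset.sum_le_sum fun j _ => by rw [hS]; exact hSij i j
        _ = a * ∑ i, ∑ j, (|D.Cdot t i j| + 1) := by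
            rw [Finset.mul_sum]
            exact Finset.sum_congr rfl fun i _ => by rw [Finset.mul_sum]
        _ ≤ a * T2 := by
            apply mul_le_mul_of_nonneg_left _ ha0
            rw [hT2]; linarith only
  -- the Taylor remainder of the quadratic term: |½ΣΣ (S_ij − (s−t)Ċ_ij) I_ij| ≤ ½ ε₂ a M CN
  have hquadR : ∀ (I : Fin N → Fin N → ℝ), (∀ i j, |I i j| ≤ M) →
      |(1 / 2) * ∑ i, ∑ j, (D.C s i j - D.C t i j) * I i j -
        (s - t) * ((1 / 2) * ∑ i, ∑ j, D.Cdot t i j * I i j)| ≤ (1 / 2) * (ε₂ * a * (M * CN)) := by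
    intro I hIb
    have hre : (1 / 2) * ∑ i, ∑ j, (D.C s i j - D.C t i j) * I i j -
        (s - t) * ((1 / 2) * ∑ i, ∑ j, D.Cdot t i j * I i j) =
        (1 / 2) * ∑ i, ∑ j, (D.C s i j - D.C t i j - (s - t) * D.Cdot t i j) * I i j := by
      have h1 : ∀ i j, (D.C s i j - D.C t i j - (s - t) * D.Cdot t i j) * I i j =
          (D.C s i j - D.C t i j) * I i j - (s - t) * (D.Cdot t i j * I i j) := fun i j => by ring
      simp only [h1, Finset.sum_sub_distrib, ← Finset.mul_sum]
      ring
    rw [hre, abs_mul, abs_of_pos (by norm_num : (0:ℝ) < 1 / 2)]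
    refine mul_le_mul_of_nonneg_left ?_ (by norm_num)
    calc |∑ i, ∑ j, (D.C s i j - D.C t i j - (s - t) * D.Cdot t i j) * I i j|
        ≤ ∑ i, ∑ j, ε₂ * a * M := by
          refine (Finset.abs_sum_le_sum_abs _ _).trans (Finset.sum_le_sum fun i _ => ?_)
          refine (Finset.abs_sum_le_sum_abs _ _).trans (Finset.sum_le_sum fun j _ => ?_)
          rw [abs_mul]
          exact mul_le_mul (hsA i j) (hIb i j) (abs_nonneg _) (by positivity)
      _ = ε₂ * a * (M * CN) := by
          rw [hCN]
          simp only [Finset.sum_const, Finset.card_univ, nsmul_eq_mul]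
          ring
  -- numeric sizes of the three error terms
  have hN1 : ε₁ * (a * T) = ε / 4 * a := by
    rw [hε₁]; field_simp
  have hN2 : 2 * M / δ ^ 2 * ((a * T2) ^ 2 * K4) ≤ ε / 4 * a := by
    have hc0 : 0 ≤ 2 * M / δ ^ 2 * K4 * T2 ^ 2 := by positivity
    have h1 : 2 * M / δ ^ 2 * K4 * T2 ^ 2 * a ≤ (2 * M / δ ^ 2 * K4 * T2 ^ 2 + 1) * a := by
      have : 0 ≤ 1 * a := by positivity
      linarith only [this]
    have h2 : (2 * M / δ ^ 2 * K4 * T2 ^ 2 + 1) * a ≤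
        (2 * M / δ ^ 2 * K4 * T2 ^ 2 + 1) * (ε / (4 * (2 * M / δ ^ 2 * K4 * T2 ^ 2 + 1))) :=
      mul_le_mul_of_nonneg_left hsD.le (by positivity)
    have h3 : (2 * M / δ ^ 2 * K4 * T2 ^ 2 + 1) * (ε / (4 * (2 * M / δ ^ 2 * K4 * T2 ^ 2 + 1))) =
        ε / 4 := by
      field_simp
    calc 2 * M / δ ^ 2 * ((a * T2) ^ 2 * K4) = (2 * M / δ ^ 2 * K4 * T2 ^ 2 * a) * a := by ring
      _ ≤ ε / 4 * a := mul_le_mul_of_nonneg_right (by linarith only [h1, h2, h3]) ha0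
  have hN3 : (1 / 2) * (ε₂ * a * (M * CN)) ≤ ε / 4 * a := by
    have h1 : ε₂ * (M * CN) ≤ ε / 4 := by
      calc ε₂ * (M * CN) ≤ ε / (4 * (M * CN + 1)) * (M * CN + 1) :=
            mul_le_mul hε₂2 (by linarith) (by positivity) (by positivity)
        _ = ε / 4 := by field_simp
    calc (1 / 2) * (ε₂ * a * (M * CN)) = (1 / 2) * a * (ε₂ * (M * CN)) := by ring
      _ ≤ (1 / 2) * a * (ε / 4) := mul_le_mul_of_nonneg_left h1 (by positivity)
      _ ≤ ε / 4 * a := by linarith only [mul_nonneg hε.le ha0]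
  -- names for the scalar quantities at `y`
  set Zs : ℝ := ∫ ζ, G (y + ζ) ∂(multivariateGaussian 0 (D.C s)) with hZs
  set Zt : ℝ := ∫ ζ, G (y + ζ) ∂(multivariateGaussian 0 (D.C t)) with hZt
  set Q : ℝ := (s - t) * ((1 / 2) * ∑ i, ∑ j, D.Cdot t i j *
    ∫ w, D2 (y + w) (EuclideanSpace.single i 1) (EuclideanSpace.single j 1)
      ∂(multivariateGaussian 0 (D.C t))) with hQ
  set P3 : ℝ := (1 / 2) * ∑ i, ∑ j, (D.C s i j - D.C t i j) *
    ∫ w, D2 (y + w) (EuclideanSpace.single i 1) (EuclideanSpace.single j 1)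
      ∂(multivariateGaussian 0 (D.C t)) with hP3
  have hQ3 : |P3 - Q| ≤ ε / 4 * a :=
    (hquadR (fun i j => ∫ w, D2 (y + w) (EuclideanSpace.single i 1)
      (EuclideanSpace.single j 1) ∂(multivariateGaussian 0 (D.C t))) (fun i j => hI t i j y)).trans hN3
  rcases le_or_gt t s with hts | hst
  · -- Case `t ≤ s`: expansion based at `C_t`
    have hE := abs_integral_C_sub_integral_C_sub_sum_le D hG1 hG2 hD2m hGb hM hδ hUCδ ht.le hts y
    obtain ⟨htr1, hl1⟩ := htr (D.C s - D.C t) (fun i j => by simp [Matrix.sub_apply])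
    have hP3' : (1 / 2) * ∑ i, ∑ j, (D.C s - D.C t) i j *
        ∫ w, D2 (y + w) (EuclideanSpace.single i 1) (EuclideanSpace.single j 1)
          ∂(multivariateGaussian 0 (D.C t)) = P3 := by
      simp only [Matrix.sub_apply, hP3]
    rw [hP3'] at hE
    have hE' : |Zs - Zt - P3| ≤ ε / 4 * a + ε / 4 * a := by
      rw [← hK4, ← hZs, ← hZt] at hE
      refine hE.trans ?_
      have h8 : (∑ i, ∑ j, |(D.C s - D.C t) i j|) ^ 2 ≤ (a * T2) ^ 2 :=
        pow_le_pow_left₀ (Finset.sum_nonneg fun i _ => Finset.sum_nonneg fun j _ =>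
          abs_nonneg _) hl1 2
      have h9 : ε₁ * ∑ i, (D.C s - D.C t) i i ≤ ε₁ * (a * T) :=
        mul_le_mul_of_nonneg_left htr1 hε₁0.le
      have h10 : 2 * M / δ ^ 2 * ((∑ i, ∑ j, |(D.C s - D.C t) i j|) ^ 2 * K4) ≤
          2 * M / δ ^ 2 * ((a * T2) ^ 2 * K4) :=
        mul_le_mul_of_nonneg_left (mul_le_mul_of_nonneg_right h8 hK40) (by positivity)
      linarith only [h9, h10, hN1, hN2]
    calc |Zs - Zt - Q| ≤ |Zs - Zt - P3| + |P3 - Q| := abs_sub_le (Zs - Zt) P3 Q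
      _ ≤ (ε / 4 * a + ε / 4 * a) + ε / 4 * a := add_le_add hE' hQ3
      _ ≤ ε * a := by linarith only [mul_nonneg hε.le ha0]
  · -- Case `s < t` (`0 < s`): expansion based at `C_s`, plus the sup-norm continuity of the smoothed
    -- Hessian entries between the scales `s` and `t`
    set P1 : ℝ := (1 / 2) * ∑ i, ∑ j, (D.C t - D.C s) i j *
      ∫ w, D2 (y + w) (EuclideanSpace.single i 1) (EuclideanSpace.single j 1)
        ∂(multivariateGaussian 0 (D.C s)) with hP1
    set P2 : ℝ := (1 / 2) * ∑ i, ∑ j, (D.C t - D.C s) i j *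
      ((∫ w, D2 (y + w) (EuclideanSpace.single i 1) (EuclideanSpace.single j 1)
        ∂(multivariateGaussian 0 (D.C s))) -
       ∫ w, D2 (y + w) (EuclideanSpace.single i 1) (EuclideanSpace.single j 1)
        ∂(multivariateGaussian 0 (D.C t))) with hP2
    have hE := abs_integral_C_sub_integral_C_sub_sum_le D hG1 hG2 hD2m hGb hM hδ hUCδ hs0.le hst.le y
    obtain ⟨htr1, hl1⟩ := htr (D.C t - D.C s) (fun i j => by
      simp only [Matrix.sub_apply]; rw [abs_sub_comm])
    have hE' : |Zt - Zs - P1| ≤ ε / 4 * a + ε / 4 * a := by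
      rw [← hK4, ← hP1, ← hZs, ← hZt] at hE
      refine hE.trans ?_
      have h8 : (∑ i, ∑ j, |(D.C t - D.C s) i j|) ^ 2 ≤ (a * T2) ^ 2 :=
        pow_le_pow_left₀ (Finset.sum_nonneg fun i _ => Finset.sum_nonneg fun j _ =>
          abs_nonneg _) hl1 2
      have h9 : ε₁ * ∑ i, (D.C t - D.C s) i i ≤ ε₁ * (a * T) :=
        mul_le_mul_of_nonneg_left htr1 hε₁0.le
      have h10 : 2 * M / δ ^ 2 * ((∑ i, ∑ j, |(D.C t - D.C s) i j|) ^ 2 * K4) ≤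
          2 * M / δ ^ 2 * ((a * T2) ^ 2 * K4) :=
        mul_le_mul_of_nonneg_left (mul_le_mul_of_nonneg_right h8 hK40) (by positivity)
      linarith only [h9, h10, hN1, hN2]
    -- sup-norm continuity of the Hessian averages: |I_s − I_t| ≤ ε₃
    have hIs : ∀ i j, |(∫ w, D2 (y + w) (EuclideanSpace.single i 1) (EuclideanSpace.single j 1)
        ∂(multivariateGaussian 0 (D.C s))) -
        ∫ w, D2 (y + w) (EuclideanSpace.single i 1) (EuclideanSpace.single j 1)
          ∂(multivariateGaussian 0 (D.C t))| ≤ ε₃ := by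
      intro i j
      obtain ⟨hc2, hb2, -⟩ := eval₂_facts' hM hUC i j
      have h := abs_integral_add_sub_integral_le hc2.measurable hb2 hδ₃ (hUCδ₃ i j)
        (D.posSemidef_C hs0.le) (D.posSemidef_C_sub hs0.le hst.le) y
      rw [add_sub_cancel] at h
      rw [abs_sub_comm]
      refine h.trans ?_
      have e : ∑ i, (D.C t - D.C s) i i = ∑ i, (D.C t i i - D.C s i i) :=
        Finset.sum_congr rfl fun i _ => by simp [Matrix.sub_apply]
      rw [e]
      have h5 : 2 * M / δ₃ ^ 2 * ∑ i, (D.C t i i - D.C s i i) ≤ ε₃ / 2 :=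
        le_trans (mul_le_mul_of_nonneg_left (le_abs_self _) (by positivity)) hsE.le
      linarith only [h5]
    have hE3 : |P2| ≤ ε / 4 * a := by
      rw [hP2, abs_mul, abs_of_pos (by norm_num : (0:ℝ) < 1 / 2)]
      have h6 : |∑ i, ∑ j, (D.C t - D.C s) i j *
          ((∫ w, D2 (y + w) (EuclideanSpace.single i 1) (EuclideanSpace.single j 1)
            ∂(multivariateGaussian 0 (D.C s))) -
           ∫ w, D2 (y + w) (EuclideanSpace.single i 1) (EuclideanSpace.single j 1)
            ∂(multivariateGaussian 0 (D.C t)))| ≤ (a * T2) * ε₃ := by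
        calc _ ≤ ∑ i, ∑ j, |(D.C t - D.C s) i j| * ε₃ := by
              refine (Finset.abs_sum_le_sum_abs _ _).trans (Finset.sum_le_sum fun i _ => ?_)
              refine (Finset.abs_sum_le_sum_abs _ _).trans (Finset.sum_le_sum fun j _ => ?_)
              rw [abs_mul]
              exact mul_le_mul_of_nonneg_left (hIs i j) (abs_nonneg _)
          _ = (∑ i, ∑ j, |(D.C t - D.C s) i j|) * ε₃ := by
              rw [Finset.sum_mul]
              exact Finset.sum_congr rfl fun i _ => by rw [Finset.sum_mul]
          _ ≤ (a * T2) * ε₃ := mul_le_mul_of_nonneg_right hl1 hε₃0.le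
      have h7 : (a * T2) * ε₃ = ε / 4 * a := by rw [hε₃]; field_simp
      calc (1 / 2) * |∑ i, ∑ j, (D.C t - D.C s) i j *
            ((∫ w, D2 (y + w) (EuclideanSpace.single i 1) (EuclideanSpace.single j 1)
              ∂(multivariateGaussian 0 (D.C s))) -
             ∫ w, D2 (y + w) (EuclideanSpace.single i 1) (EuclideanSpace.single j 1)
              ∂(multivariateGaussian 0 (D.C t)))| ≤ (1 / 2) * ((a * T2) * ε₃) :=
            mul_le_mul_of_nonneg_left h6 (by norm_num)
        _ ≤ ε / 4 * a := by rw [h7]; linarith only [mul_nonneg hε.le ha0]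
    -- the algebraic decomposition `Zs − Zt − Q = −(Zt − Zs − P1) − P2 + (P3 − Q)`
    have hP : P1 - P2 + P3 = 0 := by
      rw [hP1, hP2, hP3, ← mul_sub, ← mul_add, ← Finset.sum_sub_distrib, ← Finset.sum_add_distrib]
      have hin : ∀ i, ((∑ j, (D.C t - D.C s) i j *
            ∫ w, D2 (y + w) (EuclideanSpace.single i 1) (EuclideanSpace.single j 1)
              ∂(multivariateGaussian 0 (D.C s))) -
          ∑ j, (D.C t - D.C s) i j *
            ((∫ w, D2 (y + w) (EuclideanSpace.single i 1) (EuclideanSpace.single j 1)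
              ∂(multivariateGaussian 0 (D.C s))) -
             ∫ w, D2 (y + w) (EuclideanSpace.single i 1) (EuclideanSpace.single j 1)
              ∂(multivariateGaussian 0 (D.C t)))) +
          ∑ j, (D.C s i j - D.C t i j) *
            ∫ w, D2 (y + w) (EuclideanSpace.single i 1) (EuclideanSpace.single j 1)
              ∂(multivariateGaussian 0 (D.C t)) = 0 := by
        intro i
        rw [← Finset.sum_sub_distrib, ← Finset.sum_add_distrib]
        refine Finset.sum_eq_zero fun j _ => ?_
        simp only [Matrix.sub_apply]
        ring
      rw [Finset.sum_eq_zero fun i _ => hin i, mul_zero]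
    have hdec : Zs - Zt - Q = -(Zt - Zs - P1) + -P2 + (P3 - Q) := by
      linear_combination (-1 : ℝ) * hP
    rw [hdec]
    calc |-(Zt - Zs - P1) + -P2 + (P3 - Q)| ≤ |-(Zt - Zs - P1)| + |-P2| + |P3 - Q| :=
          abs_add_three (-(Zt - Zs - P1)) (-P2) (P3 - Q)
      _ = |Zt - Zs - P1| + |P2| + |P3 - Q| := by rw [abs_neg, abs_neg]
      _ ≤ (ε / 4 * a + ε / 4 * a) + ε / 4 * a + ε / 4 * a := add_le_add (add_le_add hE' hE3) hQ3
      _ = ε * a := by ring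

/-- **Differentiating the fluctuation average of a time-dependent family.**  Let `C_t` be a covariance
decomposition (possibly degenerate `Ċ_t`), `t > 0`, and `K : ℝ → ℝ^N → ℝ` a family with: every `K_s`
continuous and `|K_s| ≤ K₀`; `K_t` twice Fréchet differentiable with `D²K_t` bounded and uniformly
continuous; and `s ↦ K_s(y)` differentiable at `s = t` uniformly in `y` — for every `ε > 0`, eventually
`sup_y |K_s(y) − K_t(y) − (s−t)K̇(y)| ≤ ε|s−t|` — with `K̇` continuous, bounded and uniformly continuous.
Then `s ↦ E_{C_∞−C_s}[K_s(φ+·)]` is differentiable at `t` with derivative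
`−½ Σ_{ij} Ċ_t^{ij} E_{C_∞−C_t}[∂_i∂_jK_t(φ+·)] + E_{C_∞−C_t}[K̇(φ+·)]`
(covariance part: the backward heat equation of `C_∞ − C_t`, [BBD] Prop 5; integrand part: the uniform
slope plus the weak continuity of the fluctuation measures — the differentiation pattern of [BBD]'s proofs
of Prop 8 and Theorem 3 («both `ν_t` and `F_t` vary with `t`, but in a dual way», p0016 L85–88)).
[cite: BauerschmidtBodineauDagallier2023, Proposition 8 (proof)] -/
theorem hasDerivAt_integral_family_Cinf_sub (K : ℝ → EuclideanSpace ℝ (Fin N) → ℝ)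
    {DK : EuclideanSpace ℝ (Fin N) → EuclideanSpace ℝ (Fin N) →L[ℝ] ℝ}
    {D2K : EuclideanSpace ℝ (Fin N) → EuclideanSpace ℝ (Fin N) →L[ℝ] EuclideanSpace ℝ (Fin N) →L[ℝ] ℝ}
    (Kd : EuclideanSpace ℝ (Fin N) → ℝ) {t : ℝ} (ht : 0 < t)
    (h1 : ∀ y, HasFDerivAt (K t) (DK y) y) (h2 : ∀ y, HasFDerivAt DK (D2K y) y)
    (hKc : ∀ s, Continuous (K s)) {K0 : ℝ} (hKb : ∀ s y, |K s y| ≤ K0)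
    {MK : ℝ} (hMK : ∀ y, ‖D2K y‖ ≤ MK) (hUCK : UniformContinuous D2K)
    (hKdc : Continuous Kd) {Kd0 : ℝ} (hKdb : ∀ y, |Kd y| ≤ Kd0) (hKduc : UniformContinuous Kd)
    (hU : ∀ ε : ℝ, 0 < ε → ∀ᶠ s in 𝓝 t, ∀ y : EuclideanSpace ℝ (Fin N),
      |K s y - K t y - (s - t) * Kd y| ≤ ε * |s - t|)
    (φ : EuclideanSpace ℝ (Fin N)) :
    HasDerivAt (fun s => ∫ x, K s (φ + x) ∂(multivariateGaussian 0 (D.Cinf - D.C s)))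
      (-((1 / 2) * ∑ i, ∑ j, D.Cdot t i j *
          ∫ x, D2K (φ + x) (EuclideanSpace.single i 1) (EuclideanSpace.single j 1)
            ∂(multivariateGaussian 0 (D.Cinf - D.C t))) +
        ∫ x, Kd (φ + x) ∂(multivariateGaussian 0 (D.Cinf - D.C t))) t := by
  -- (1) covariance part: fixed integrand `K_t`, moving covariance `C_∞ − C_s`
  have hv := hasDerivAt_integral_gaussian_Cinf_sub D h1 h2 (hKb t) hMK hUCK ht φ
  -- integrable pieces over a probability measure
  have hInt : ∀ (G : EuclideanSpace ℝ (Fin N) → ℝ), Continuous G → ∀ C : ℝ, (∀ y, |G y| ≤ C) →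
      ∀ (P : Measure (EuclideanSpace ℝ (Fin N))) [IsProbabilityMeasure P],
        Integrable (fun x => G (φ + x)) P := by
    intro G hGc C hGC P _
    exact Integrable.of_bound (hGc.comp (continuous_const.add continuous_id)).aestronglyMeasurable C
      (Eventually.of_forall fun x => by rw [Real.norm_eq_abs]; exact hGC (φ + x))
  -- (2) the slope decomposition `u = v + (u − v)`
  set u : ℝ → ℝ := fun s => ∫ x, K s (φ + x) ∂(multivariateGaussian 0 (D.Cinf - D.C s)) with hu
  set v : ℝ → ℝ := fun s => ∫ x, K t (φ + x) ∂(multivariateGaussian 0 (D.Cinf - D.C s)) with hvdef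
  set W : ℝ := ∫ x, Kd (φ + x) ∂(multivariateGaussian 0 (D.Cinf - D.C t)) with hW
  have huv : ∀ s, u s - v s = ∫ x, (K s (φ + x) - K t (φ + x))
      ∂(multivariateGaussian 0 (D.Cinf - D.C s)) := by
    intro s
    rw [hu, hvdef]
    exact (integral_sub (hInt (K s) (hKc s) K0 (hKb s) _) (hInt (K t) (hKc t) K0 (hKb t) _)).symm
  have hut : u t = v t := by rw [hu, hvdef]
  rw [hasDerivAt_iff_tendsto_slope]
  have hvs := hasDerivAt_iff_tendsto_slope.mp hv
  have hslope : ∀ s, slope u t s = slope v t s + (s - t)⁻¹ * (u s - v s) := by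
    intro s
    rw [slope_def_field, slope_def_field, hut]
    ring
  -- (3) the integrand part: `(s−t)⁻¹ (u s − v s) → W`
  have hX : Tendsto (fun s => (s - t)⁻¹ * (u s - v s)) (𝓝[≠] t) (𝓝 W) := by
    have hcont : Tendsto (fun s => ∫ x, Kd (φ + x) ∂(multivariateGaussian 0 (D.Cinf - D.C s)))
        (𝓝[≠] t) (𝓝 W) := by
      have h := tendsto_integral_gaussian_Cinf_sub_Ici D hKdc.measurable hKdb hKduc ht.le φ
      rw [nhdsWithin_eq_nhds.2 (Ici_mem_nhds ht)] at h
      exact h.mono_left nhdsWithin_le_nhds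
    rw [Metric.tendsto_nhds]
    intro ε hε
    have ev1 := (hU (ε / 4) (by positivity)).filter_mono (nhdsWithin_le_nhds (s := ({t}ᶜ : Set ℝ)) (a := t))
    have ev2 := Metric.tendsto_nhds.mp hcont _ (half_pos hε)
    have ev3 : ∀ᶠ s in 𝓝[≠] t, s ≠ t := self_mem_nhdsWithin
    filter_upwards [ev1, ev2, ev3] with s hs1 hs2 hs3
    have hst : s - t ≠ 0 := sub_ne_zero.2 hs3
    rw [huv s, ← integral_const_mul, Real.dist_eq]
    rw [Real.dist_eq] at hs2
    have hI1 : Integrable (fun x => (s - t)⁻¹ * (K s (φ + x) - K t (φ + x)))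
        (multivariateGaussian 0 (D.Cinf - D.C s)) :=
      hInt (fun y => (s - t)⁻¹ * (K s y - K t y)) (continuous_const.mul ((hKc s).sub (hKc t)))
        (|(s - t)⁻¹| * (K0 + K0)) (fun y => by
          rw [abs_mul]
          refine mul_le_mul_of_nonneg_left ?_ (abs_nonneg _)
          exact (abs_sub _ _).trans (add_le_add (hKb s y) (hKb t y))) _
    have hI2 : Integrable (fun x => Kd (φ + x)) (multivariateGaussian 0 (D.Cinf - D.C s)) :=
      hInt Kd hKdc Kd0 hKdb _
    have hpt : ∀ x, |(s - t)⁻¹ * (K s (φ + x) - K t (φ + x)) - Kd (φ + x)| ≤ ε / 4 := by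
      intro x
      have h1 := hs1 (φ + x)
      have hid : (s - t)⁻¹ * (K s (φ + x) - K t (φ + x)) - Kd (φ + x) =
          (s - t)⁻¹ * (K s (φ + x) - K t (φ + x) - (s - t) * Kd (φ + x)) := by
        field_simp
      rw [hid, abs_mul, abs_inv]
      calc |s - t|⁻¹ * |K s (φ + x) - K t (φ + x) - (s - t) * Kd (φ + x)|
          ≤ |s - t|⁻¹ * (ε / 4 * |s - t|) :=
            mul_le_mul_of_nonneg_left h1 (inv_nonneg.2 (abs_nonneg _))
        _ = ε / 4 := by
            have hane : |s - t| ≠ 0 := abs_ne_zero.2 hst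
            field_simp
    have hT1 := abs_integral_le_of_abs_le' (multivariateGaussian 0 (D.Cinf - D.C s)) hpt
    rw [integral_sub hI1 hI2] at hT1
    calc _ ≤ |(∫ x, (s - t)⁻¹ * (K s (φ + x) - K t (φ + x)) ∂(multivariateGaussian 0 (D.Cinf - D.C s))) -
            ∫ x, Kd (φ + x) ∂(multivariateGaussian 0 (D.Cinf - D.C s))| +
          |(∫ x, Kd (φ + x) ∂(multivariateGaussian 0 (D.Cinf - D.C s))) - W| := abs_sub_le _ _ _
      _ < ε / 4 + ε / 2 := add_lt_add_of_le_of_lt hT1 hs2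
      _ < ε := by linarith
  refine (hvs.add hX).congr' ?_
  exact Eventually.of_forall fun s => (hslope s).symm

end Family

end Polchinski

end Literature.Analysis.FunctionSpaces

end
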